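import Summits.Ventures.LatticeQCDFlow.Scoring.LagProductCLT
import Summits.Ventures.LatticeQCDFlow.Scoring.MeanSubtractionCLT

/-!
# The JOINT CLT holds for the SCORERS' estimator: `√N ((Γ̂_c(t))_{t≤W} − (γ(t))_{t≤W}) ⇒ N(0, Σ)` with the same `Σ`

HONEST FRAMING: exact (Metropolis-corrected) sampling algorithms for lattice gauge theory;
figures of merit are autocorrelation/cost numbers at stated couplings and volumes; no
continuum-physics claim.

Venture `LatticeQCDFlow` (cell pub-lqcd), sub-topic `Scoring`; FANOUT row 16 (`su2-base`), GEN-8.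
NEW WORK of the cell — the docking of GEN-8's `Scoring/MeanSubtractionCLT` (`√N (Γ̂_c(t) − Γ̂(t)) → 0`
in probability, lag by lag) with GEN-7's joint CLT `Scoring/LagProductCLT.tendstoInDistribution_acovHat`
(known mean, `1/N`); no definition; nothing cited as a fact.  Printed counterpart NAMED ONLY:
Brockwell–Davis 1991 Prop. 7.3.4.

## Contents

* `tendstoInMeasure_euclidean_zero` — coordinatewise `→ 0` in measure ⇒ `→ 0` in measure in
  `EuclideanSpace ℝ (Fin (W+1))` (finite union bound on `‖v‖² = Σ_t v_t²`).
* `measurable_acovHatC` — the centred estimator is measurable.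
* **`tendstoInDistribution_acovHatC`** — `ξ` i.i.d., `X_i = F(ξ_i..ξ_{i+m})` with `X_0 ∈ L²` and
  square-integrable CENTRED lag products, `μ = E X_0`, `γ(t) = E[(X_0 − μ)(X_t − μ)] = cov[X_0, X_t]`,
  `Z` with `⟪a, Z⟫ ~ N(0, aᵀ Σ a)`, `Σ = lagProdACov (X − μ) (m + W)`: then for the scorers' centred,
  `1/(N−t)`-normalised `Γ̂_c` (GEN-6 `acovHatC`), `√N • ((Γ̂_c(t))_{t≤W} − (γ(t))_{t≤W}) ⇒ Z` — the
  same limit as the packet's known-mean statistic (Slutsky: the difference `→ 0` in measure).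

NOT CLAIMED: anything at second order; Markov-chain data; data-chosen `W` (see
`Scoring/MadrasSokalDataWindow` for the transfer at a strict crossing).
-/

noncomputable section

open MeasureTheory ProbabilityTheory Filter Finset WithLp
open scoped Topology ENNReal RealInnerProductSpace
open Literature.Probability.MarkovChains (seqMean)

namespace Summit.Ventures.LatticeQCDFlow.Scoring

/-! ## Coordinatewise convergence in measure in `ℝ^{W+1}` -/

section Coord

variable {Ω : Type*} [MeasurableSpace Ω] {P : Measure Ω}

/-- **Coordinatewise null ⇒ null in `ℝ^{W+1}`**: if every coordinate of `V_N` tends to `0` in measure,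
so does `V_N` in `EuclideanSpace ℝ (Fin (W+1))` (`‖v‖ ≤ Σ_t |v_t|`, finite union bound). -/
theorem tendstoInMeasure_euclidean_zero {W : ℕ} {V : ℕ → Ω → EuclideanSpace ℝ (Fin (W + 1))}
    (h : ∀ t : Fin (W + 1), TendstoInMeasure P (fun N ω => V N ω t) atTop fun _ => 0) :
    TendstoInMeasure P V atTop fun _ => 0 := by
  rw [tendstoInMeasure_iff_norm]
  intro ε hε
  have hW : (0 : ℝ) < (W + 1 : ℕ) := by positivity
  set δ : ℝ := ε / (W + 1 : ℕ) with hδ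
  have hδpos : 0 < δ := div_pos hε hW
  -- if every `|v_t| < δ = ε/(W+1)` then `‖v‖ = √(Σ |v_t|²) < ε`
  have hsub : ∀ N, {ω | ε ≤ ‖V N ω - 0‖} ⊆ ⋃ t : Fin (W + 1), {ω | δ ≤ ‖V N ω t - 0‖} := by
    intro N ω hω
    simp only [sub_zero, Set.mem_setOf_eq, Set.mem_iUnion] at hω ⊢
    by_contra hno
    push Not at hno
    have hlt : ∑ t : Fin (W + 1), ‖V N ω t‖ ^ 2 < ∑ _t : Fin (W + 1), δ ^ 2 :=
      sum_lt_sum_of_nonempty univ_nonempty fun t _ => by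
        have := hno t
        have h0 := norm_nonneg (V N ω t)
        nlinarith
    rw [sum_const, card_univ, Fintype.card_fin, nsmul_eq_mul] at hlt
    have hW1 : (1 : ℝ) ≤ (W + 1 : ℕ) := by exact_mod_cast Nat.succ_le_succ (Nat.zero_le W)
    have hbound : ((W + 1 : ℕ) : ℝ) * δ ^ 2 ≤ ε ^ 2 := by
      have hε' : ε = (W + 1 : ℕ) * δ := by rw [hδ, mul_div_cancel₀ _ hW.ne']
      rw [hε', mul_pow]
      have hsq : ((W + 1 : ℕ) : ℝ) ≤ ((W + 1 : ℕ) : ℝ) ^ 2 := by nlinarith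
      exact mul_le_mul_of_nonneg_right hsq (sq_nonneg δ)
    have hnorm : ‖V N ω‖ < ε := by
      rw [EuclideanSpace.norm_eq]
      calc Real.sqrt (∑ t, ‖V N ω t‖ ^ 2) < Real.sqrt (ε ^ 2) :=
            Real.sqrt_lt_sqrt (sum_nonneg fun t _ => sq_nonneg _) (hlt.trans_le hbound)
        _ = ε := Real.sqrt_sq hε.le
    linarith
  have h0 : Tendsto (fun N => ∑ t : Fin (W + 1), P {ω | δ ≤ ‖V N ω t - 0‖}) atTop (𝓝 0) := by
    have := tendsto_finsetSum (univ : Finset (Fin (W + 1))) fun t _ =>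
      (tendstoInMeasure_iff_norm.1 (h t)) δ hδpos
    simpa only [sum_const_zero] using this
  exact tendsto_of_tendsto_of_tendsto_of_le_of_le tendsto_const_nhds h0 (fun _ => bot_le)
    fun N => (measure_mono (hsub N)).trans (measure_iUnion_fintype_le _ _)

/-- The centred estimator `Γ̂_c(t)` of a family of measurable coordinates is measurable. -/
theorem measurable_acovHatC {X : ℕ → Ω → ℝ} (hX : ∀ i, Measurable (X i)) (N t : ℕ) :
    Measurable (acovHatC X N t) := by
  have hm : Measurable (seqMean N X) := (Finset.measurable_sum _ fun i _ => hX i).div_const _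
  unfold acovHatC
  exact (Finset.measurable_sum _ fun i _ => ((hX i).sub hm).mul ((hX _).sub hm)).div_const _

end Coord

/-! ## The joint CLT for the scorers' estimator -/

section Joint

variable {Ω : Type*} [MeasurableSpace Ω] {P : Measure Ω} [IsProbabilityMeasure P]
variable {Ω' : Type*} [MeasurableSpace Ω'] {P' : Measure Ω'} [IsProbabilityMeasure P']
variable {S : Type*} [MeasurableSpace S] {ξ : ℕ → Ω → S} {m : ℕ} {F : (Fin (m + 1) → S) → ℝ}

/-- **THE JOINT CLT FOR THE SCORERS' CENTRED, `1/(N−t)`-NORMALISED AUTOCOVARIANCES.**  `ξ` i.i.d.,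
`X_i = F(ξ_i, …, ξ_{i+m})`, `X_0 ∈ L²`, `μ = E X_0`, the centred lag products `(X_0 − μ)(X_t − μ)` square
integrable, `γ(t) = E[(X_0 − μ)(X_t − μ)]`, and `Z` a random vector of `ℝ^{W+1}` with
`⟪a, Z⟫ ~ N(0, aᵀ Σ a)`, `Σ = lagProdACov (X − μ) (m + W)` (Bartlett's covariance of the CENTRED process).
Then `√N • ((Γ̂_c(t))_{t≤W} − (γ(t))_{t≤W}) ⇒ Z`: mean subtraction and the `1/(N−t)` normalisation do
not change the limit law. -/
theorem tendstoInDistribution_acovHatC (hξ : ∀ i, Measurable (ξ i)) (hind : iIndepFun ξ P)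
    (hid : ∀ i, IdentDistrib (ξ i) (ξ 0) P P) (hF : Measurable F)
    (h2 : MemLp (blockFactor F ξ 0) 2 P)
    (h4c : ∀ t, MemLp (fun ω => (blockFactor F ξ 0 ω - P[blockFactor F ξ 0])
      * (blockFactor F ξ t ω - P[blockFactor F ξ 0])) 2 P) (W : ℕ)
    {Z : Ω' → EuclideanSpace ℝ (Fin (W + 1))} (hZm : AEMeasurable Z P')
    (hZ : ∀ a : EuclideanSpace ℝ (Fin (W + 1)), HasLaw (fun ω' => ⟪a, Z ω'⟫) (gaussianReal 0
      (∑ s : Fin (W + 1), ∑ t : Fin (W + 1), a s * a t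
        * lagProdACov (fun i ω => blockFactor F ξ i ω - P[blockFactor F ξ 0]) P (m + W) s t).toNNReal)
      P') :
    TendstoInDistribution
      (fun (N : ℕ) ω => Real.sqrt N • (toLp 2 (fun t : Fin (W + 1) => acovHatC (blockFactor F ξ) N t ω)
        - toLp 2 (fun t : Fin (W + 1) => P[fun ω => (blockFactor F ξ 0 ω - P[blockFactor F ξ 0])
            * (blockFactor F ξ t ω - P[blockFactor F ξ 0])])))
      atTop Z (fun _ => P) P' := by
  set μ : ℝ := P[blockFactor F ξ 0] with hμ
  set Fc : (Fin (m + 1) → S) → ℝ := fun w => F w - μ with hFc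
  have hFc_m : Measurable Fc := hF.sub_const _
  have hY : (fun i ω => blockFactor F ξ i ω - μ) = blockFactor Fc ξ := rfl
  -- the packet's CLT for the centred block factor `Y = X − μ` (stated with the target's centring)
  have hclt : TendstoInDistribution
      (fun (N : ℕ) ω => Real.sqrt N • (toLp 2 (fun t : Fin (W + 1) => acovHat (blockFactor Fc ξ) N t ω)
        - toLp 2 (fun t : Fin (W + 1) => P[fun ω => (blockFactor F ξ 0 ω - μ)
            * (blockFactor F ξ t ω - μ)])))
      atTop Z (fun _ => P) P' :=
    tendstoInDistribution_acovHat (F := Fc) hξ hind hid hFc_m h4c W hZm hZ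
  -- the difference of the two statistics `→ 0` in measure, coordinate by coordinate
  have hdiff : TendstoInMeasure P (fun (N : ℕ) ω => Real.sqrt N
      • (toLp 2 (fun t : Fin (W + 1) => acovHatC (blockFactor F ξ) N t ω)
        - toLp 2 (fun t : Fin (W + 1) => acovHat (blockFactor Fc ξ) N t ω))) atTop fun _ => 0 := by
    refine tendstoInMeasure_euclidean_zero fun t => ?_
    have h := tendstoInMeasure_sqrt_mul_acovHatC_sub_acovHat_blockFactor hξ hind hid hF h2 t
    rw [← hμ, hY] at h
    refine h.congr (fun N => Eventually.of_forall fun ω => ?_) EventuallyEq.rfl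
    simp only [WithLp.ofLp_smul, WithLp.ofLp_sub, Pi.smul_apply, Pi.sub_apply, smul_eq_mul]
  have hm : ∀ N : ℕ, AEMeasurable (fun ω => Real.sqrt N
      • (toLp 2 (fun t : Fin (W + 1) => acovHatC (blockFactor F ξ) N t ω)
        - toLp 2 (fun t : Fin (W + 1) => P[fun ω => (blockFactor F ξ 0 ω - μ)
            * (blockFactor F ξ t ω - μ)]))) P :=
    fun N => by
    have hv : Measurable fun ω => toLp 2 (fun t : Fin (W + 1) => acovHatC (blockFactor F ξ) N t ω) :=
      (WithLp.measurable_toLp 2 _).comp (measurable_pi_lambda _ fun t : Fin (W + 1) =>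
        measurable_acovHatC (fun i => measurable_blockFactor hξ hF i) N t)
    exact ((hv.sub_const _).const_smul (Real.sqrt (N : ℝ))).aemeasurable
  refine tendstoInDistribution_of_tendstoInMeasure_sub _ _ hclt ?_ hm
  refine hdiff.congr (fun N => Eventually.of_forall fun ω => ?_) EventuallyEq.rfl
  simp only [Pi.sub_apply, smul_sub]
  abel

end Joint

end Summit.Ventures.LatticeQCDFlow.Scoring

end

noncomputable section

open MeasureTheory ProbabilityTheory Filter Finset WithLp
open scoped Topology ENNReal RealInnerProductSpace

namespace Summit.Ventures.LatticeQCDFlow.Scoring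

/-! ## (GEN-8, appended) Lag by lag, with no limit object: `√N (Γ̂_c(t) − γ(t)) ⇒ N(0, Σ_c(t,t))`

The joint statement above needs a limit vector `Z`.  For ONE lag of the scorers' centred estimator no
construction is needed: GEN-8's scalar per-lag CLT for the centred block factor
(`LagProductCLT.tendstoInDistribution_acovHat_lag`) plus the scalar `o_p(1)` comparison of
`MeanSubtractionCLT` give the law of the error bar on a single printed `Γ̂_c(t)`. -/

section PerLag

variable {Ω : Type*} [MeasurableSpace Ω] {P : Measure Ω} [IsProbabilityMeasure P]
variable {Ω' : Type*} [MeasurableSpace Ω'] {P' : Measure Ω'} [IsProbabilityMeasure P']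
variable {S : Type*} [MeasurableSpace S] {ξ : ℕ → Ω → S} {m : ℕ} {F : (Fin (m + 1) → S) → ℝ}

/-- **THE CLT FOR ONE CENTRED, `1/(N−t)`-NORMALISED AUTOCOVARIANCE.**  `ξ` i.i.d.,
`X_i = F(ξ_i..ξ_{i+m})`, `X_0 ∈ L²`, `μ = E X_0`, centred lag products square integrable, `t ≤ W`,
`γ(t) = E[(X_0 − μ)(X_t − μ)]`, `Y` ANY real variable with law `N(0, Σ_c(t,t))`,
`Σ_c = lagProdACov (X − μ) (m + W)`.  Then `√N (Γ̂_c(t) − γ(t)) ⇒ Y`. -/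
theorem tendstoInDistribution_acovHatC_lag (hξ : ∀ i, Measurable (ξ i)) (hind : iIndepFun ξ P)
    (hid : ∀ i, IdentDistrib (ξ i) (ξ 0) P P) (hF : Measurable F)
    (h2 : MemLp (blockFactor F ξ 0) 2 P)
    (h4c : ∀ t, MemLp (fun ω => (blockFactor F ξ 0 ω - P[blockFactor F ξ 0])
      * (blockFactor F ξ t ω - P[blockFactor F ξ 0])) 2 P) {W : ℕ} (t : Fin (W + 1)) {Y : Ω' → ℝ}
    (hY : HasLaw Y (gaussianReal 0 (lagProdACov (fun i ω => blockFactor F ξ i ω - P[blockFactor F ξ 0])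
      P (m + W) t t).toNNReal) P') :
    TendstoInDistribution
      (fun (N : ℕ) ω => Real.sqrt N * (acovHatC (blockFactor F ξ) N t ω
        - P[fun ω => (blockFactor F ξ 0 ω - P[blockFactor F ξ 0])
            * (blockFactor F ξ t ω - P[blockFactor F ξ 0])]))
      atTop Y (fun _ => P) P' := by
  set μ : ℝ := P[blockFactor F ξ 0] with hμ
  set Fc : (Fin (m + 1) → S) → ℝ := fun w => F w - μ with hFc
  have hFc_m : Measurable Fc := hF.sub_const _
  have hY' : (fun i ω => blockFactor F ξ i ω - μ) = blockFactor Fc ξ := rfl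
  -- the packet's scalar CLT for the centred factor
  have hclt : TendstoInDistribution (fun (N : ℕ) ω => Real.sqrt N
      * (acovHat (blockFactor Fc ξ) N t ω - P[fun ω => (blockFactor F ξ 0 ω - μ)
          * (blockFactor F ξ t ω - μ)])) atTop Y (fun _ => P) P' :=
    tendstoInDistribution_acovHat_lag (F := Fc) hξ hind hid hFc_m h4c t hY
  -- the scalar `o_p(1)` difference
  have hdiff : TendstoInMeasure P (fun (N : ℕ) ω => Real.sqrt N
      * (acovHatC (blockFactor F ξ) N t ω - acovHat (blockFactor Fc ξ) N t ω)) atTop fun _ => 0 := by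
    have h := tendstoInMeasure_sqrt_mul_acovHatC_sub_acovHat_blockFactor hξ hind hid hF h2 t
    rw [← hμ, hY'] at h
    exact h
  have hm : ∀ N : ℕ, AEMeasurable (fun ω => Real.sqrt N * (acovHatC (blockFactor F ξ) N t ω
      - P[fun ω => (blockFactor F ξ 0 ω - μ) * (blockFactor F ξ t ω - μ)])) P := fun N =>
    (((measurable_acovHatC (fun i => measurable_blockFactor hξ hF i) N t).sub_const _).const_mul
      _).aemeasurable
  refine tendstoInDistribution_of_tendstoInMeasure_sub _ _ hclt ?_ hm
  refine hdiff.congr (fun N => Eventually.of_forall fun ω => ?_) EventuallyEq.rfl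
  simp only [Pi.sub_apply]
  ring

/-- **The same with NO limit object at all**: convergence in distribution to the identity of
`(ℝ, N(0, Σ_c(t,t)))`. -/
theorem tendstoInDistribution_acovHatC_lag_gaussianReal (hξ : ∀ i, Measurable (ξ i))
    (hind : iIndepFun ξ P) (hid : ∀ i, IdentDistrib (ξ i) (ξ 0) P P) (hF : Measurable F)
    (h2 : MemLp (blockFactor F ξ 0) 2 P)
    (h4c : ∀ t, MemLp (fun ω => (blockFactor F ξ 0 ω - P[blockFactor F ξ 0])
      * (blockFactor F ξ t ω - P[blockFactor F ξ 0])) 2 P) {W : ℕ} (t : Fin (W + 1)) :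
    TendstoInDistribution
      (fun (N : ℕ) ω => Real.sqrt N * (acovHatC (blockFactor F ξ) N t ω
        - P[fun ω => (blockFactor F ξ 0 ω - P[blockFactor F ξ 0])
            * (blockFactor F ξ t ω - P[blockFactor F ξ 0])]))
      atTop id (fun _ => P) (gaussianReal 0 (lagProdACov (fun i ω =>
        blockFactor F ξ i ω - P[blockFactor F ξ 0]) P (m + W) t t).toNNReal) :=
  tendstoInDistribution_acovHatC_lag hξ hind hid hF h2 h4c t HasLaw.id

end PerLag

end Summit.Ventures.LatticeQCDFlow.Scoring

end
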